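import Literature.Geometry.Lorentzian.CoordShrinkerRmNormSqDrift
import HarnessLib

/-!
# Route EntropyRung — registered helper `helper_mwRmNormSqDrift` (crux stmt-SmoothPoincare4-10868)

Line `collapsed-ends-usc`, crux `EntropyRung.NoncompactShrinkerGap`: the `Rm`-equation input of the
maximum-principle step in Munteanu–Wang 2015, Thm. 1.4 (a complete 4-d gradient shrinker with bounded
scalar curvature has bounded `Rm`), at chart level. For metric components `G` with
`Ric + Hess f = ½ G` on `V ⊆ E`, `dim E = 4`, positive definite at `x ∈ V`, there is `N ≥ 0`
(`= |∇Rm|²` in a `G x`-orthonormal frame) with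
`Δ|Rm|² − d|Rm|²(∇f) ≥ 2N − C(√|Rm|² + 1)|Rm|²` and `|∇|Rm|²|² ≤ 4|Rm|² N`, for the universal
constant `C = 16·4⁶ + 4·4⁷`. Both clauses are the Literature theorems
`IsMetricOn.lapAt_rmNormSqAt_sub_fderiv_ge_of_soliton` and `IsMetricOn.gradSqAt_rmNormSqAt_le`
(`Literature/Geometry/Lorentzian/CoordShrinkerRmNormSqDrift.lean`) in an orthonormal basis
(`exists_orthonormal_basis`), specialised to `λ = ½`, `n = 4`. No definition and no named fact is
introduced.
-/

noncomputable section

-- the registered namespace `Summit.SmoothPoincare4.SmoothPoincare4.Theorems` repeats a component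
set_option linter.dupNamespace false

open scoped ContDiff Topology
open Set Filter Module Literature.Geometry.Lorentzian

namespace Summit.SmoothPoincare4.SmoothPoincare4.Theorems.NoncompactShrinkerGapMW

/-- **Registered helper `helper_mwRmNormSqDrift`** (stub of the lead's skeleton for crux
stmt-SmoothPoincare4-10868, line `collapsed-ends-usc`): on a 4-d gradient shrinker in a chart,
`Δ_f |Rm|² ≥ 2|∇Rm|² − C(|Rm| + 1)|Rm|²` and `|∇|Rm|²|² ≤ 4|Rm|²|∇Rm|²` (Munteanu–Wang 2015, §1, (id)
and the proof of Thm. 1.4). [cite: MunteanuWang2015, §1, (id) and proof of Thm. 1.4] -/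
theorem helper_mwRmNormSqDrift : ∃ C : ℝ, ∀ {E : Type} [NormedAddCommGroup E] [NormedSpace ℝ E] [FiniteDimensional ℝ E] [CompleteSpace E] (G : E → E →L[ℝ] E →L[ℝ] ℝ) (V : Set E) (x : E) (f : E → ℝ), MetricCoord.IsMetricOn G V → x ∈ V → Module.finrank ℝ E = 4 → (∀ y ∈ V, ∀ v : E, v ≠ 0 → 0 < G y v v) → ContDiffOn ℝ ∞ f V → (∀ y ∈ V, ∀ v w : E, MetricCoord.ricAt G y v w + MetricCoord.hessAt G f y v w = (1 / 2 : ℝ) * G y v w) → ∃ N : ℝ, 0 ≤ N ∧ 2 * N - C * (Real.sqrt (MetricCoord.rmNormSqAt G x) + 1) * MetricCoord.rmNormSqAt G x ≤ MetricCoord.lapAt G (MetricCoord.rmNormSqAt G) x - fderiv ℝ (MetricCoord.rmNormSqAt G) x (MetricCoord.sharpAt G x (fderiv ℝ f x)) ∧ MetricCoord.gradSqAt G (MetricCoord.rmNormSqAt G) x ≤ 4 * MetricCoord.rmNormSqAt G x * N := by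
  refine ⟨16 * 4 ^ 6 + 4 * 4 ^ 7, ?_⟩
  intro E _ _ _ _ G V x f hG hx h4 hpos hf hsol
  classical
  obtain ⟨e, he⟩ := MetricCoord.exists_orthonormal_basis (hG.symm x hx) (hpos x hx)
  refine ⟨∑ k, ∑ a, ∑ c, ∑ i, ∑ j,
    (G x (MetricCoord.covRiemAt G x (e k) (e a) (e c) (e i)) (e j)) ^ 2,
    by positivity, ?_, hG.gradSqAt_rmNormSqAt_le e he hx⟩
  have h := hG.lapAt_rmNormSqAt_sub_fderiv_ge_of_soliton e he hx hf hsol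
  have hn : (Fintype.card (Fin (finrank ℝ E)) : ℝ) = 4 := by simp [h4]
  rw [hn] at h
  have hu0 : 0 ≤ MetricCoord.rmNormSqAt G x := hG.rmNormSqAt_nonneg e he hx
  have hK0 : 0 ≤ Real.sqrt (MetricCoord.rmNormSqAt G x) := Real.sqrt_nonneg _
  nlinarith [h, hu0, hK0, mul_nonneg hu0 hK0]

end Summit.SmoothPoincare4.SmoothPoincare4.Theorems.NoncompactShrinkerGapMW

end
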